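import Mathlib.RingTheory.DedekindDomain.Factorization
import Literature.NumberTheory.DiophantineGeometry.StableFaltingsHeightMapProofs
import HarnessLib

/-!
# The denominator ideal of `j` prime by prime: `v(𝔇) = max(0, −v(j))`, and local-to-global

Topic `NumberTheory/DiophantineGeometry`; a proofs-only file (theorems only: no definitions, no
named facts), serving the finite-place half of Faltings' isogeny inequality for elliptic curves
(`WeierstrassCurve.stableFaltingsHeight_le_of_isogeny`; the reduction
`stableFaltingsHeight_le_of_isogeny_of_finitePart` of `FaltingsHeightIsogenyReductionProofs`
asks for the fractional-ideal inequality `𝔇_E · (μ) ⊆ 𝔇_{E'}`, `μ = Δ_{E'}α₀¹²/Δ_E`). Such an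
inequality is checked prime by prime; this file provides the dictionary.

For a Dedekind domain `R` with fraction field `K` and a maximal ideal `v`, Mathlib's
`FractionalIdeal.count K v I ∈ ℤ` is the exponent of `v` in the factorisation of the non-zero
fractional ideal `I` (so `count K v (spanSingleton x) = ord_v(x)` for `x ∈ Kˣ`).

* `Literature.NumberTheory.DiophantineGeometry.fractionalIdeal_le_of_forall_count_le` — for
  non-zero fractional ideals, `(∀ v, count_v J ≤ count_v I) → I ≤ J` (converse of Mathlib's
  `FractionalIdeal.count_mono`): `I J⁻¹ = ∏ v^{count_v I − count_v J}` has non-negative exponents.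
* `Literature.NumberTheory.DiophantineGeometry.count_coeIdeal_ne_zero_iff_dvd` — for an
  integral ideal `I ≠ 0`, `count_v I ≠ 0 ↔ v ∣ I`.
* `WeierstrassCurve.count_coeIdeal_jDenominatorIdeal` — **`ord_v(𝔇) = max(0, −ord_v(j))`** for the
  denominator ideal `𝔇 = {a ∈ 𝓞_K | a j ∈ 𝓞_K}` of `j = j(E)` (Silverman 1986, §2:
  `(j) = 𝔄𝔇⁻¹` with `𝔄, 𝔇` relatively prime integral ideals): `𝔄 := (j)𝔇` is integral,
  `𝔄 + 𝔇 = 𝓞_K` (the tree's `exists_add_j_mul_eq_one`), so `v` divides at most one of them, and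
  `ord_v(𝔄) = ord_v(j) + ord_v(𝔇)`.
* `WeierstrassCurve.coeIdeal_jDenominatorIdeal_mul_spanSingleton_le` — **local-to-global**: if
  `max(0, −ord_v j(E')) ≤ max(0, −ord_v j(E)) + ord_v(c)` at every `v`, then
  `𝔇_E · (c) ⊆ 𝔇_{E'}`.

## References

* [Silverman1986] J. H. Silverman, *Heights and elliptic curves*, in Cornell–Silverman,
  *Arithmetic Geometry*, Ch. X, §2 (p. 257: `(j_E) = 𝔄𝔇⁻¹`).
* [Faltings1986FinitenessTranslation] G. Faltings, *Finiteness theorems for abelian varieties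
  over number fields*, ibid. Ch. II, §3, Lemma 5.
-/

noncomputable section

open scoped Classical nonZeroDivisors

namespace Literature.NumberTheory.DiophantineGeometry

open IsDedekindDomain

variable {R : Type*} [CommRing R] [IsDedekindDomain R] {K : Type*} [Field K] [Algebra R K]
  [IsFractionRing R K]

/-- **Inclusion of fractional ideals is checked prime by prime**: for non-zero fractional
ideals `I, J` of a Dedekind domain, if `count_v J ≤ count_v I` for every maximal ideal `v` then
`I ⊆ J` (the converse of Mathlib's `FractionalIdeal.count_mono`). Indeed
`I J⁻¹ = ∏ᶠ v^{count_v I − count_v J}` (Mathlib `finprod_heightOneSpectrum_factorization'`) is a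
product of integral ideals, hence `⊆ 𝓞`, and `I = (I J⁻¹) J ⊆ J`. [folklore] -/
theorem fractionalIdeal_le_of_forall_count_le {I J : FractionalIdeal R⁰ K} (hI : I ≠ 0)
    (hJ : J ≠ 0)
    (h : ∀ v : HeightOneSpectrum R, FractionalIdeal.count K v J ≤ FractionalIdeal.count K v I) :
    I ≤ J := by
  have hQ0 : I * J⁻¹ ≠ 0 := mul_ne_zero hI (inv_ne_zero hJ)
  have hQ : I * J⁻¹ ≤ 1 := by
    rw [← FractionalIdeal.finprod_heightOneSpectrum_factorization' K hQ0]
    refine finprod_induction (fun x : FractionalIdeal R⁰ K ↦ x ≤ 1) le_rfl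
      (fun x y hx hy ↦ ?_) (fun v ↦ ?_)
    · calc x * y ≤ 1 * 1 := by gcongr
        _ = 1 := one_mul 1
    · have hn : 0 ≤ FractionalIdeal.count K v (I * J⁻¹) := by
        rw [FractionalIdeal.count_mul K v hI (inv_ne_zero hJ), FractionalIdeal.count_inv]
        linarith [h v]
      obtain ⟨n, hn'⟩ := Int.eq_ofNat_of_zero_le hn
      rw [hn', zpow_natCast]
      exact pow_le_one' FractionalIdeal.coeIdeal_le_one n
  calc I = I * J⁻¹ * J := by rw [mul_assoc, inv_mul_cancel₀ hJ, mul_one]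
    _ ≤ 1 * J := by gcongr
    _ = J := one_mul J

/-- For an integral ideal `I ≠ 0`, `count_v I ≠ 0` iff `v ∣ I` (Mathlib `FractionalIdeal.count_coe`
and `Associates.count_ne_zero_iff_dvd`). [folklore] -/
theorem count_coeIdeal_ne_zero_iff_dvd {I : Ideal R} (hI : I ≠ ⊥) (v : HeightOneSpectrum R) :
    FractionalIdeal.count K v (I : FractionalIdeal R⁰ K) ≠ 0 ↔ v.asIdeal ∣ I := by
  rw [FractionalIdeal.count_coe K v hI, Int.natCast_ne_zero,
    Associates.count_ne_zero_iff_dvd hI v.irreducible]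

end Literature.NumberTheory.DiophantineGeometry

namespace WeierstrassCurve

open NumberField IsDedekindDomain Literature.NumberTheory.DiophantineGeometry

variable {K : Type*} [Field K] [NumberField K]

/-- **`ord_v(𝔇) = max(0, −ord_v(j))`** for the denominator ideal `𝔇 = W.jDenominatorIdeal` of
`j = j(W)` and every maximal ideal `v` of `𝓞_K` (Silverman 1986, §2: `(j_E) = 𝔄𝔇⁻¹` with
`𝔄, 𝔇` relatively prime integral ideals, i.e. `𝔇 = ∏_{ord_v j < 0} v^{−ord_v j}`). Proof: the
fractional ideal `𝔄 := (j)·𝔇` is integral, `ord_v(𝔄) = ord_v(j) + ord_v(𝔇)`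
(`FractionalIdeal.count_mul`), and `𝔄 + 𝔇 = 𝓞_K` (`exists_add_j_mul_eq_one`: `a₁ + j a₂ = 1`
with `a₁, a₂ ∈ 𝔇`), so `v` does not divide both; the two cases `ord_v j ≥ 0`, `ord_v j < 0` give
the formula. (`ord_v` of an element `x` is `count K v (spanSingleton x)`.) For `j = 0`
(`𝔇 = 𝓞_K`) both sides vanish. (Dot-notation extension of Mathlib's `WeierstrassCurve`.)
[cite: Silverman1986, §2 (p. 257)] -/
theorem count_coeIdeal_jDenominatorIdeal (W : WeierstrassCurve K) [W.IsElliptic]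
    (v : HeightOneSpectrum (𝓞 K)) :
    FractionalIdeal.count K v (W.jDenominatorIdeal : FractionalIdeal (𝓞 K)⁰ K) =
      max 0 (-FractionalIdeal.count K v (FractionalIdeal.spanSingleton (𝓞 K)⁰ W.j)) := by
  set D : FractionalIdeal (𝓞 K)⁰ K := ((W.jDenominatorIdeal : Ideal (𝓞 K)) : FractionalIdeal (𝓞 K)⁰ K)
    with hD
  set Jj : FractionalIdeal (𝓞 K)⁰ K := FractionalIdeal.spanSingleton (𝓞 K)⁰ W.j with hJj
  by_cases hj : W.j = 0
  · -- `j = 0`: `𝔇 = 𝓞_K`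
    have htop : W.jDenominatorIdeal = ⊤ := by
      rw [Ideal.eq_top_iff_one, one_mem_jDenominatorIdeal_iff]
      exact ⟨0, by rw [hj]; simp⟩
    rw [hD, hJj, htop, hj, FractionalIdeal.coeIdeal_top, FractionalIdeal.count_one,
      FractionalIdeal.spanSingleton_zero, FractionalIdeal.count_zero]
    simp
  have hD0 : D ≠ 0 := FractionalIdeal.coeIdeal_ne_zero.mpr W.jDenominatorIdeal_ne_bot
  have hJj0 : Jj ≠ 0 := by
    rw [hJj, Ne, FractionalIdeal.spanSingleton_eq_zero_iff]
    exact hj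
  -- `𝔄 = (j)·𝔇` is integral
  have hA1 : Jj * D ≤ 1 := by
    rw [FractionalIdeal.mul_le]
    intro x hx y hy
    obtain ⟨z, rfl⟩ := (FractionalIdeal.mem_spanSingleton _).1 hx
    obtain ⟨a, ha, rfl⟩ := (FractionalIdeal.mem_coeIdeal _).1 hy
    obtain ⟨b, hb⟩ := (mem_jDenominatorIdeal W a).1 ha
    rw [FractionalIdeal.mem_one_iff]
    refine ⟨z * b, ?_⟩
    rw [map_mul, ← RingOfIntegers.coe_eq_algebraMap, ← RingOfIntegers.coe_eq_algebraMap,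
      ← RingOfIntegers.coe_eq_algebraMap, ← hb, Algebra.smul_def, ← RingOfIntegers.coe_eq_algebraMap]
    ring
  obtain ⟨A, hA⟩ := (FractionalIdeal.le_one_iff_exists_coeIdeal.mp hA1)
  have hA0 : (A : FractionalIdeal (𝓞 K)⁰ K) ≠ 0 := by
    rw [hA]; exact mul_ne_zero hJj0 hD0
  have hAbot : A ≠ ⊥ := FractionalIdeal.coeIdeal_ne_zero.mp hA0
  -- `ord_v 𝔄 = ord_v j + ord_v 𝔇`
  have hcount : FractionalIdeal.count K v (A : FractionalIdeal (𝓞 K)⁰ K) =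
      FractionalIdeal.count K v Jj + FractionalIdeal.count K v D := by
    rw [hA, FractionalIdeal.count_mul K v hJj0 hD0]
  -- `𝔄` and `𝔇` are coprime: `v` does not divide both
  have hcop : ¬ (FractionalIdeal.count K v D ≠ 0 ∧
      FractionalIdeal.count K v (A : FractionalIdeal (𝓞 K)⁰ K) ≠ 0) := by
    rintro ⟨h1, h2⟩
    have hdvdD : v.asIdeal ∣ W.jDenominatorIdeal :=
      (count_coeIdeal_ne_zero_iff_dvd W.jDenominatorIdeal_ne_bot v).1 h1
    have hdvdA : v.asIdeal ∣ A := (count_coeIdeal_ne_zero_iff_dvd hAbot v).1 h2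
    obtain ⟨a₁, ha₁, a₂, ha₂, hsum⟩ := W.exists_add_j_mul_eq_one
    obtain ⟨b, hb⟩ := (mem_jDenominatorIdeal W a₂).1 ha₂
    -- `b = a₂ j ∈ 𝔄`
    have hbA : b ∈ A := by
      have hmem : algebraMap (𝓞 K) K b ∈ (A : FractionalIdeal (𝓞 K)⁰ K) := by
        rw [hA, ← RingOfIntegers.coe_eq_algebraMap, ← hb, mul_comm ((a₂ : 𝓞 K) : K) W.j]
        exact FractionalIdeal.mul_mem_mul (FractionalIdeal.mem_spanSingleton_self _ _)
          (FractionalIdeal.mem_coeIdeal_of_mem _ ha₂)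
      obtain ⟨b', hb', hbb'⟩ := (FractionalIdeal.mem_coeIdeal _).1 hmem
      rwa [← IsFractionRing.injective (𝓞 K) K hbb']
    -- `1 = a₁ + b ∈ v`
    have hone : (1 : 𝓞 K) = a₁ + b := by
      apply IsFractionRing.injective (𝓞 K) K
      rw [map_one, map_add, ← RingOfIntegers.coe_eq_algebraMap, ← RingOfIntegers.coe_eq_algebraMap,
        ← hb, ← hsum]
      ring
    have h1v : (1 : 𝓞 K) ∈ v.asIdeal := by
      rw [hone]
      exact v.asIdeal.add_mem (Ideal.le_of_dvd hdvdD ha₁) (Ideal.le_of_dvd hdvdA hbA)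
    exact v.isPrime.ne_top ((Ideal.eq_top_iff_one _).2 h1v)
  have hDnn : 0 ≤ FractionalIdeal.count K v D := FractionalIdeal.count_coe_nonneg K v _
  have hAnn : 0 ≤ FractionalIdeal.count K v (A : FractionalIdeal (𝓞 K)⁰ K) :=
    FractionalIdeal.count_coe_nonneg K v _
  omega

/-- **Local-to-global for the finite part of Faltings' isogeny inequality.** For elliptic
curves `W, W'` over a number field `K` and `c ∈ Kˣ`, if at every maximal ideal `v` of `𝓞_K`
`max(0, −ord_v j(W')) ≤ max(0, −ord_v j(W)) + ord_v(c)`, then `𝔇_W · (c) ⊆ 𝔇_{W'}` as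
fractional ideals (`count_coeIdeal_jDenominatorIdeal` and
`fractionalIdeal_le_of_forall_count_le`). With `c = Δ_{W'}α¹²/Δ_W` for the multiplier `α` of
an isogeny `W → W'` this is the hypothesis (D) of
`stableFaltingsHeight_le_of_isogeny_of_finitePart`, so the finite-place half of Faltings'
Lemma 5 for elliptic curves is a statement about the three valuations
`ord_v j(W), ord_v j(W'), ord_v(Δ_{W'}α¹²/Δ_W)` at each finite place.
(Dot-notation extension of Mathlib's `WeierstrassCurve`.)
[cite: Faltings1986FinitenessTranslation, §3 Lemma 5 (proof)] -/
theorem coeIdeal_jDenominatorIdeal_mul_spanSingleton_le (W W' : WeierstrassCurve K)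
    [W.IsElliptic] [W'.IsElliptic] {c : K} (hc : c ≠ 0)
    (h : ∀ v : HeightOneSpectrum (𝓞 K),
      max 0 (-FractionalIdeal.count K v (FractionalIdeal.spanSingleton (𝓞 K)⁰ W'.j)) ≤
        max 0 (-FractionalIdeal.count K v (FractionalIdeal.spanSingleton (𝓞 K)⁰ W.j)) +
          FractionalIdeal.count K v (FractionalIdeal.spanSingleton (𝓞 K)⁰ c)) :
    (W.jDenominatorIdeal : FractionalIdeal (𝓞 K)⁰ K) * FractionalIdeal.spanSingleton (𝓞 K)⁰ c ≤
      (W'.jDenominatorIdeal : FractionalIdeal (𝓞 K)⁰ K) := by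
  have hD0 : (W.jDenominatorIdeal : FractionalIdeal (𝓞 K)⁰ K) ≠ 0 :=
    FractionalIdeal.coeIdeal_ne_zero.mpr W.jDenominatorIdeal_ne_bot
  have hD'0 : (W'.jDenominatorIdeal : FractionalIdeal (𝓞 K)⁰ K) ≠ 0 :=
    FractionalIdeal.coeIdeal_ne_zero.mpr W'.jDenominatorIdeal_ne_bot
  have hc0 : FractionalIdeal.spanSingleton (𝓞 K)⁰ c ≠ 0 := by
    rw [Ne, FractionalIdeal.spanSingleton_eq_zero_iff]
    exact hc
  refine fractionalIdeal_le_of_forall_count_le (mul_ne_zero hD0 hc0) hD'0 fun v ↦ ?_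
  rw [FractionalIdeal.count_mul K v hD0 hc0, count_coeIdeal_jDenominatorIdeal,
    count_coeIdeal_jDenominatorIdeal]
  exact h v

end WeierstrassCurve

end
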